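import Literature.RingTheory.GradedAlgebra.ProjFlatOfFlatPieces
import HarnessLib

/-!
# The `R`-algebra structure on homogeneous localizations of a graded `R`-algebra

For a graded `R`-algebra `A = ⊕ᵢ 𝒜 i` (`𝒜 : ι → Submodule R A`, Mathlib `GradedAlgebra 𝒜`) and
a submonoid `x ⊆ A`, Mathlib equips the homogeneous localization `HomogeneousLocalization 𝒜 x`
(the degree-`0` part of `A_x`; `Away 𝒜 f` for `x = {fⁿ}`) with an `𝒜 0`-algebra structure
(`HomogeneousLocalization.fromZeroRingHom`) and with the scalar action of `R` on numerators
(`HomogeneousLocalization.instSMul`, `val_smul`), but NOT with an `R`-module / `R`-algebra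
structure. This file supplies them, as reducible `def`s (not instances) whose scalar
multiplication IS Mathlib's numerator action — so that `letI := algebraOfGradedAlgebra 𝒜 x`
introduces no competing `SMul R` — together with the compatibilities one needs:

* `moduleOfGradedAlgebra 𝒜 x : Module R (HomogeneousLocalization 𝒜 x)`,
  `algebraOfGradedAlgebra 𝒜 x : Algebra R (HomogeneousLocalization 𝒜 x)`;
* `val_algebraMap`, `algebraMap_eq` — its `algebraMap` is `R → 𝒜 0 → A_{(x)}`
  (`fromZeroRingHom ∘ algebraMap`); `isScalarTower_localization`;
* `flat_away_of_flat_pieces'`, `flat_away_quotient_torsion_of_flat_pieces'` — the flatness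
  theorems of `ProjFlatOfFlatPieces.lean` (Hartshorne III.9.9 (ii) ⇒ (i)) restated as
  `Module.Flat R …` for this structure.

Standard (EGA II (2.2.1): `S_{(f)}` is an `S₀`-algebra, hence an algebra over any ring mapping to
`S₀`); pure plumbing, everything proved. [folklore]

## References

* [EGAII] A. Grothendieck, J. Dieudonné, *ÉGA II*, (2.2.1)–(2.2.2) (homogeneous localization).
* [Hartshorne1977] R. Hartshorne, *Algebraic Geometry*, III Thm. 9.9 (for the restated flatness).
-/

noncomputable section

open HomogeneousLocalization

namespace Literature.RingTheory.GradedAlgebra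

variable {ι R A : Type*} [CommRing R] [CommRing A] [Algebra R A] [DecidableEq ι]
  [AddCommMonoid ι] (𝒜 : ι → Submodule R A) [GradedAlgebra 𝒜] (x : Submonoid A)

/-- The `R`-module structure on `A_{(x)}` whose scalar multiplication is Mathlib's action on
numerators (`r • (a/s) = (r a)/s`), transported along the injection `val : A_{(x)} → A_x`.
[folklore] -/
abbrev moduleOfGradedAlgebra : Module R (HomogeneousLocalization 𝒜 x) :=
  Function.Injective.module R
    (⟨⟨HomogeneousLocalization.val, val_zero⟩, val_add⟩ : HomogeneousLocalization 𝒜 x →+ _)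
    (HomogeneousLocalization.val_injective x) (val_smul x)

/-- The `R`-algebra structure on `A_{(x)}` (same scalar multiplication). [folklore] -/
abbrev algebraOfGradedAlgebra : Algebra R (HomogeneousLocalization 𝒜 x) :=
  letI := moduleOfGradedAlgebra 𝒜 x
  Algebra.ofModule
    (fun r y z => HomogeneousLocalization.val_injective x <| by
      change (r • y * z).val = (r • (y * z)).val
      rw [val_mul, val_smul, val_smul, val_mul, smul_mul_assoc])
    (fun r y z => HomogeneousLocalization.val_injective x <| by
      change (y * r • z).val = (r • (y * z)).val
      rw [val_mul, val_smul, val_smul, val_mul, mul_smul_comm])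

/-- `val (algebraMap r) = algebraMap r` in `A_x`: the `R`-algebra structure of `A_{(x)}` is the one
induced from `A_x ⊇ A_{(x)}` (EGA II (2.2.1): `S_{(f)}` is the degree-`0` subring of `S_f`).
[cite: EGAII, (2.2.1)] -/
theorem val_algebraMap (r : R) :
    (@algebraMap R (HomogeneousLocalization 𝒜 x) _ _ (algebraOfGradedAlgebra 𝒜 x) r).val =
      algebraMap R (Localization x) r := by
  letI := algebraOfGradedAlgebra 𝒜 x
  show (algebraMap R (HomogeneousLocalization 𝒜 x) r).val = algebraMap R (Localization x) r
  rw [Algebra.algebraMap_eq_smul_one, Algebra.algebraMap_eq_smul_one]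
  change (r • (1 : HomogeneousLocalization 𝒜 x)).val = _
  rw [val_smul, val_one]

/-- `IsScalarTower R A_{(x)} A_x` for this structure (`A_{(x)} ⊆ A_x` is a sub-`R`-algebra,
EGA II (2.2.1)). [cite: EGAII, (2.2.1)] -/
theorem isScalarTower_localization :
    @IsScalarTower R (HomogeneousLocalization 𝒜 x) (Localization x)
      (algebraOfGradedAlgebra 𝒜 x).toSMul _ _ := by
  letI := algebraOfGradedAlgebra 𝒜 x
  show IsScalarTower R (HomogeneousLocalization 𝒜 x) (Localization x)
  refine IsScalarTower.of_algebraMap_eq (R := R) (S := HomogeneousLocalization 𝒜 x)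
    (A := Localization x) fun r => ?_
  exact (val_algebraMap 𝒜 x r).symm

/-- The `algebraMap` of `algebraOfGradedAlgebra` is `R → 𝒜 0 → A_{(x)}` (`S_{(f)}` is an
`S₀`-algebra, EGA II (2.2.1)). [cite: EGAII, (2.2.1)] -/
theorem algebraMap_eq :
    @algebraMap R (HomogeneousLocalization 𝒜 x) _ _ (algebraOfGradedAlgebra 𝒜 x) =
      (fromZeroRingHom 𝒜 x).comp (algebraMap R (𝒜 0)) := by
  letI := algebraOfGradedAlgebra 𝒜 x
  show algebraMap R (HomogeneousLocalization 𝒜 x) = _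
  refine RingHom.ext fun r => HomogeneousLocalization.val_injective x ?_
  rw [val_algebraMap, RingHom.comp_apply,
    show ((fromZeroRingHom 𝒜 x) (algebraMap R (𝒜 0) r)).val =
      Localization.mk ((algebraMap R (𝒜 0) r : 𝒜 0) : A) 1 from rfl,
    SetLike.GradeZero.coe_algebraMap, Localization.mk_algebraMap]

/-! ## The flatness theorems for this structure -/

/-- **Hartshorne III.9.9 (ii) ⇒ (i)**, as `Module.Flat R (Away 𝒜 f)` for `algebraOfGradedAlgebra`:
flat graded pieces `𝒜 n`, `n ≥ k`, give a flat `A_{(f)}` (`f ∈ 𝒜 d`, `d ≥ 1`).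
[cite: Hartshorne1977, III Thm. 9.9, proof of (ii) ⇒ (i), p. 262] -/
theorem flat_away_of_flat_pieces' {𝒜 : ℕ → Submodule R A} [GradedAlgebra 𝒜] {f : A} {d : ℕ}
    (hf : f ∈ 𝒜 d) (hd : 0 < d) {k : ℕ} (hflat : ∀ n, k ≤ n → Module.Flat R (𝒜 n)) :
    @Module.Flat R (HomogeneousLocalization.Away 𝒜 f) _ _
      (algebraOfGradedAlgebra 𝒜 (Submonoid.powers f)).toModule := by
  letI := algebraOfGradedAlgebra 𝒜 (Submonoid.powers f)
  show Module.Flat R (HomogeneousLocalization.Away 𝒜 f)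
  rw [← RingHom.flat_algebraMap_iff, algebraMap_eq]
  exact flat_away_of_flat_pieces 𝒜 hf hd hflat

/-- **Hartshorne III.9.9 (ii) ⇒ (i) for strict transforms**, as `Module.Flat R` for
`algebraOfGradedAlgebra`: if `𝒜 n / 𝒜 n[c^∞]` is flat for `n ≥ k` then so is
`A_{(f)} / A_{(f)}[c^∞]`. [cite: Hartshorne1977, III Thm. 9.9, proof of (ii) ⇒ (i), p. 262]
[cite: StacksProject, Tag 080D] -/
theorem flat_away_quotient_torsion_of_flat_pieces' {𝒜 : ℕ → Submodule R A} [GradedAlgebra 𝒜]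
    {f : A} {d : ℕ} (hf : f ∈ 𝒜 d) (hd : 0 < d) (c : R) {k : ℕ}
    (hflat : ∀ n, k ≤ n →
      Module.Flat R (𝒜 n ⧸ ⨆ m : ℕ, Submodule.torsionBy R (𝒜 n) (c ^ m))) :
    letI := algebraOfGradedAlgebra 𝒜 (Submonoid.powers f)
    Module.Flat R (HomogeneousLocalization.Away 𝒜 f ⧸
      ⨆ m : ℕ, Submodule.torsionBy R (HomogeneousLocalization.Away 𝒜 f) (c ^ m)) := by
  letI := algebraOfGradedAlgebra 𝒜 (Submonoid.powers f)
  show Module.Flat R (HomogeneousLocalization.Away 𝒜 f ⧸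
      ⨆ m : ℕ, Submodule.torsionBy R (HomogeneousLocalization.Away 𝒜 f) (c ^ m))
  exact flat_away_quotient_torsion_of_flat_pieces 𝒜 (algebraMap_eq 𝒜 _) hf hd c hflat

end Literature.RingTheory.GradedAlgebra

end
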